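import Summits.AtomisticToContinuum.BoseEinsteinCondensation.Theses.BECJelliumDischarge
import Literature.MathematicalPhysics.QuantumManyBody.JelliumBoseGas
import HarnessLib

/-!
# Line `plasmon-gap-removal` — crux `ChargedGasBEC` (stmt-AtomisticToContinuum-13668), route `BECJelliumDischarge`

ALTERNATIVE skeleton line (crux-strategist `cstrat-stmt-AtomisticToContinuum-13668-s1`, 2026-08-17), next to
the registrar's live line `Lines/birth.lean` (local condensation + phase locking), which it does NOT replace.
The crux, BY NAME: `Summit.AtomisticToContinuum.BoseEinsteinCondensation.Theses.BECJelliumDischarge.ChargedGasBEC`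
(its inline `let`s unfold definitionally to `JelliumBoseGas.chargedCondensateNumber`, see `birth.lean`).

## The lever: the charged KLS/Wagner PARTICLE-REMOVAL moment inequality, fed by the PLASMON GAP

This is the TRANSFER of the dead neutral line `Cruxes/PeriodicIRBound/Lines/linear-ph-floor-wagner` (route
BECGroundStateSOS; KLS1988 / Wagner architecture) to the charged gas, at exactly its two dead stubs:
(α) the Landau momentum-sector floor `c|k|` (stmt-9091, unserved) is replaced by a `k`-INDEPENDENT SPECTRAL
GAP `ω ≍ ω_p = √(8πκ)·ρ^{2/3}` of the NEUTRAL `(N−1)`-particle charged Hamiltonian in the same box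
(background density `ρ' = ρ(N−1)/N`; Foldy/Bogoliubov: the single branch `E_k = √(k⁴ + ω_p²)` is gapped at
every `k`; a gap needs no momentum sectors, so the Dirichlet box of the crux is fine); (β) the one-particle-precision convexity of `E₀` in `N` (stmt-9094) DISAPPEARS: every
chemical-potential / Koopmans-defect quantity entering the removal inequality is `O(κρ^{2/3})` (Onsager scale)
or `O(κ^{5/4}ρ^{2/3})` (Foldy scale), a power of `κ` below the gap `√κ·ρ^{2/3}` — the plasmon/interaction
scale separation `√q ≫ q` of jellium at weak coupling (small `r_s ≈ 0.31κ`) is what the neutral gas lacks.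
Only REMOVAL states `a(φ)Ψ` are used (no creation operator), so hard cores never produce an infinite double
commutator (the `NonIntegrableHalf` / C⁺(1) saga of the neutral lines does not arise).

Summing the removal inequality over a full one-particle orthonormal basis `{φ_j}` (Parseval in the first
variable) gives, for ANY symmetric normalised `Ψ ∈ C¹` with Dirichlet support and any `ω` below the gap of
the reference `H'_{N−1}` = `N−1` bosons in the same box `L` with the REDUCED, NEUTRALISING background
`ρ' = ρ(N−1)/N` (one-body term `qρ'(6πL² − V₁)`):
`ω·(N − λ_max(γ_Ψ)) ≤ Z(Ψ) := (N−1)·T_{h'}(Ψ) + (N−2)·W(Ψ) − N·E₀(N−1, ρ')`,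
where `T_{h'}` = kinetic + (shifted) `ρ'`-background one-body energy of `Ψ`, `W` = core + Coulomb pair
energy, because `Σ_j ⟨a(φ_j)Ψ, H'_{N−1} a(φ_j)Ψ⟩ = (N−1)T_{h'} + (N−2)W` (symmetry of `Ψ`),
`Σ_j ‖a(φ_j)Ψ‖² = N`, `Σ_j |⟨Φ₀', a(φ_j)Ψ⟩|² = ‖ξ‖² ≤ λ_max(γ_Ψ)` and `H' − E₀' ≥ ω(1 − |Φ₀'⟩⟨Φ₀'|)`.
`Z ≥ 0` variationally; `Z` is invariant under constant shifts of the one-body potential and `= 0` at Hartree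
level; `Z_Bogoliubov = Σ_{k≠0} n_k E_k = Σ_k v_k² E_k = |E_Foldy| ≈ 0.48 κ^{5/4}ρ^{2/3} N` at `v = 0` — so
`N − λ_max ≲ κ^{3/4} N`, Foldy's depletion law `N₊/N = 0.211 r_s^{3/4}` with the right exponent.
WHY THE NEUTRAL REFERENCE (and not the bare `(N−1)`-system on the `N`-background): bounding `Z` uses the
non-symmetric insertion trial state `Φ ⊗ √(ρ_Ψ/N)` (Boltzmann = Bose ground energy), whose Hartree term is
`(q/N)D(ρ_Ψ, ρ_Φ)`; against the neutral reference the background-potential terms cancel up to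
`(q/N)D(ρ_b1_Λ, σ_Ψ) = O(κρ^{2/3}·L/…)` and what is left is `qD(σ_Ψ, σ'_Φ) − qD(σ_Ψ,σ_Ψ) − 2qE_xc(Ψ)`,
bounded by Cauchy–Schwarz in the Coulomb norm, the two energy budgets, Lieb–Oxford and Onsager — all
`O(κρ^{2/3}N)`; against the bare reference an uncancelled `q∫V_bg(σ_Φ − σ_Ψ)` (`V_bg ≍ ρL²`) would demand a
cross-`N` comparison of boundary layers, which no present technology gives.

## Stubs (3) and composition

* `stub_pairGap` — THE PLASMON GAP (open; hardest): for admissible `v`, small `κ`, small `ρ`, eventually in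
  `N`: `E₀(N−1,ρ') < ⊤` and the Ky Fan two-frame infimum of `chargedEnergy v q ρ'` over L²-ORTHOGONAL pairs of
  `(N−1)`-particle trial states (NEUTRAL background `ρ' = ρ(N−1)/N`, box `L_N = (N/ρ)^{1/3}`, `q = κρ^{1/3}`)
  is `≥ 2E₀(N−1,ρ') + c_g √κ ρ^{2/3}`
  (`λ₁ + λ₂ ≥ 2λ₁ + ω`, i.e. spectral gap `≥ ω`; physically `ω ≈ c_cube·ω_p`, `c_cube` the lowest surface-plasmon
  depolarisation of the cube with its Dirichlet depletion layer; mean-field check: kit j023284).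
* `stub_removalInequality` — THE CHARGED KLS/WAGNER REMOVAL INEQUALITY (M–L, provable now in principle): for
  all `v q ρ_b N L ω`: finiteness + pair gap `ω` for `N−1` ⇒ for every `Ψ : TrialState N L`,
  `ofReal ω · N ≤ ofReal ω · maxOccupation N Ψ + ((N−1)T_h(Ψ) + (N−2)W(Ψ) − N·E₀(N−1))` (ℝ≥0∞, truncated `−`
  harmless since the bracket is `≥ 0`). Ingredients: removal states are C¹ Dirichlet symmetric; Parseval in
  `x₁`; Ky Fan / 2×2 min-max for the variational gap; `‖ξ‖² ≤ maxOccupation`.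
* `stub_koopmansDefect` — THE KOOPMANS-DEFECT BOUND (L–XL): for near-minimisers `Ψ` of the neutral `N`-problem,
  `Z(Ψ) ≤ C_Z κ ρ^{2/3} N` against the NEUTRAL `(N−1)`-reference (proof plan: Boltzmann = Bose ground energy;
  insertion trial `Φ ⊗ √(ρ_Ψ/N)` (+ Dyson dressing for hard cores) so `E₀(N,ρ) ≤ E₀(N−1,ρ') + …`; then
  `Z ≤ qD(σ_Ψ,σ'_Φ) − qD(σ_Ψ,σ_Ψ) − 2qE_xc(Ψ) + O(κρ^{2/3}N)` with Cauchy–Schwarz in the Coulomb norm, the two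
  energy budgets, Lieb–Oxford (+ a no-piling bound `∫ρ^{4/3} ≤ CNρ^{1/3}`, CLY/LS2001 Lemma 4.1 type) and
  Onsager (`JelliumOnsagerBound`); no boundary-layer analysis, no cross-`N` comparison; true value
  `≈ (0.48κ^{5/4} + O((ρa³)^{1/3}/κ·…))ρ^{2/3}N`).
* `ChargedGasBEC_of_sigs` (kernel-checked, no sorry): `κ₀ := min κ₁ κ₂ (c_g/(2(C_Z+1)))²`, so that
  `C_Zκ ≤ c_g√κ/2`; then `ωN ≤ ω·λ_max + ωN/2`, cancel, divide by `ofReal ω`: `λ_max ≥ N/2` on every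
  `δ`-near-minimiser, `δ` from `stub_koopmansDefect`; `JelliumBoseGas.le_chargedCondensateNumber` closes with
  `c = 1/2`. `ChargedGasBEC_of` concludes the crux BY NAME (definitional unfolding of the route item's `let`s).

Disproof used: none exists for 13668 (`ledger crux ls`, 2026-08-17). Negatives index (20): nothing on gaps /
removal inequalities. Barriers: `KineticGapLengthScales(+Narrow)` binds ENERGY-WINDOW arguments for constant-mode
BEC — this line's input on the state is NOT its energy window but the spectral gap of the `(N−1)`-system plus
the `λ_max`-target (explicitly outside the narrowed class); `EnergyAsymptoticsWithoutCondensation`: no stub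
consumes `foldyLaw` — only Onsager-scale bounds against a `√κ` gap; `BogoliubovPerturbationInfrared`: no expansion.
-/

noncomputable section

namespace Summit.AtomisticToContinuum.BoseEinsteinCondensation.Cruxes.ChargedGasBEC.PlasmonGapRemoval

open MeasureTheory ENNReal Filter
open scoped ComplexConjugate
open Literature.MathematicalPhysics.QuantumManyBody.BoseGas
open Literature.MathematicalPhysics.QuantumManyBody.JelliumBoseGas
open Summit.AtomisticToContinuum.BoseEinsteinCondensation.Theses.BECJelliumDischarge

/-! ## Registered stubs -/

/-- **stub 1 — the plasmon gap (Ky Fan two-frame form) of the NEUTRAL `(N−1)`-system, uniformly in the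
volume.** For every admissible core `v` there are `c_g > 0` and `κ₀ > 0` such that for `0 < κ < κ₀` there
is `ρ₀ > 0` with: for `0 < ρ < ρ₀` and all large `N`, with `L = sideLength ρ N`, `q = κρ^{1/3}` and the
REDUCED background density `ρ' = ρ(N−1)/N` (so `N−1` bosons neutralise it exactly):
`E₀(N−1,ρ') := chargedGroundStateEnergy v q ρ' (N−1) L ≠ ⊤` and for every pair of L²-orthogonal trial
states `Φ₁ ⊥ Φ₂ : TrialState (N−1) L`, `chargedEnergy v q ρ' Φ₁ + chargedEnergy v q ρ' Φ₂ ≥ 2·E₀(N−1,ρ')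
+ c_g·√κ·ρ^{2/3}` — i.e. `λ₂ − λ₁ ≥ ω := c_g√κρ^{2/3}` (`≍ ω_p = √(8πκ)ρ^{2/3}`, the plasmon; physically
`ω ≈ c_cube ω_p` with `c_cube` the lowest surface-plasmon depolarisation of the cube, mean-field slab check
kit j023325). Products of trial states are bounded with compact support, so the Bochner orthogonality
integral never takes a junk value. -/
theorem stub_pairGap :
    ∀ v : ℝ → ℝ≥0∞, IsRepulsiveFiniteRange v →
      ∃ cg : ℝ, 0 < cg ∧ ∃ κ₀ : ℝ, 0 < κ₀ ∧ ∀ κ : ℝ, 0 < κ → κ < κ₀ →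
        ∃ ρ₀ : ℝ, 0 < ρ₀ ∧ ∀ ρ : ℝ, 0 < ρ → ρ < ρ₀ →
          ∀ᶠ N : ℕ in atTop,
            chargedGroundStateEnergy v (κ * ρ ^ (1 / 3 : ℝ)) (ρ * ((N - 1 : ℕ) : ℝ) / (N : ℝ)) (N - 1)
                (sideLength ρ N) ≠ ⊤ ∧
            2 * chargedGroundStateEnergy v (κ * ρ ^ (1 / 3 : ℝ)) (ρ * ((N - 1 : ℕ) : ℝ) / (N : ℝ)) (N - 1)
                  (sideLength ρ N) +
                ENNReal.ofReal (cg * Real.sqrt κ * ρ ^ (2 / 3 : ℝ)) ≤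
              ⨅ (Φ₁ : TrialState (N - 1) (sideLength ρ N)) (Φ₂ : TrialState (N - 1) (sideLength ρ N))
                (_ : ∫ X, conj (Φ₁.ψ X) * Φ₂.ψ X = 0),
                chargedEnergy v (κ * ρ ^ (1 / 3 : ℝ)) (ρ * ((N - 1 : ℕ) : ℝ) / (N : ℝ)) Φ₁ +
                  chargedEnergy v (κ * ρ ^ (1 / 3 : ℝ)) (ρ * ((N - 1 : ℕ) : ℝ) / (N : ℝ)) Φ₂ := by
  sorry

/-- **stub 2 — the charged Kennedy–Lieb–Shastry / Wagner particle-REMOVAL inequality** (abstract in all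
parameters; the REFERENCE background `ρ_b` is free — the line uses `ρ_b := ρ(N−1)/N`). If the
`(N−1)`-particle charged problem in the box `Λ_L` (core `v`, coupling `q`, background `ρ_b`) has finite
ground-state energy and Ky Fan pair gap `ω`, then for EVERY `N`-particle trial state `Ψ`:
`ofReal ω · N ≤ ofReal ω · λ_max(γ_Ψ) + Z(Ψ)`, `Z(Ψ) = (N−1)·T_h(Ψ) + (N−2)·W(Ψ) − N·E₀(N−1)`, where
`T_h(Ψ) = ∫(|∇Ψ|² + q·Σᵢ ρ_b(6πL² − ∫_Λ|xᵢ−y|⁻¹dy)·|Ψ|²)` (kinetic + shifted background) and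
`W(Ψ) = ∫(Σ_{i<j} v(|xᵢ−xⱼ|) + q·Σ_{i<j}|xᵢ−xⱼ|⁻¹)|Ψ|²` (pair energy), so `T_h + W = chargedEnergy v q ρ_b Ψ`.
Proof route: for an orthonormal basis `{φ_j}` of one-particle modes, the removal states
`Q_j = √N ∫ conj(φ_j(x)) Ψ(x, ·) dx` are `C¹`, Dirichlet, symmetric; `Σ_j ⟨Q_j, H_{N−1} Q_j⟩ = (N−1)T_h + (N−2)W`
and `Σ_j ‖Q_j‖² = N` (Parseval in `x₁`, symmetry of `Ψ`); the gap gives `⟨Q,(H_{N−1} − E₀)Q⟩ ≥ ω(‖Q‖² − |⟨Φ₀,Q⟩|²)`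
(2×2 min-max against near-minimisers `Φ₀`); and `Σ_j |⟨Φ₀, Q_j⟩|² = ‖ξ‖²`, `ξ = √N⟨Φ₀, Ψ(x,·)⟩`, with
`‖ξ‖² ≤ occupation N (ξ/‖ξ‖) Ψ ≤ maxOccupation N Ψ`. The truncated subtraction is harmless: the bracket is
`≥ 0` by the variational principle. -/
theorem stub_removalInequality :
    ∀ (v : ℝ → ℝ≥0∞) (q ρb : ℝ) (N : ℕ) (L ω : ℝ),
      chargedGroundStateEnergy v q ρb (N - 1) L ≠ ⊤ →
      2 * chargedGroundStateEnergy v q ρb (N - 1) L + ENNReal.ofReal ω ≤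
          ⨅ (Φ₁ : TrialState (N - 1) L) (Φ₂ : TrialState (N - 1) L)
            (_ : ∫ X, conj (Φ₁.ψ X) * Φ₂.ψ X = 0),
            chargedEnergy v q ρb Φ₁ + chargedEnergy v q ρb Φ₂ →
      ∀ Ψ : TrialState N L,
        ENNReal.ofReal ω * N ≤ ENNReal.ofReal ω * maxOccupation N Ψ.ψ +
          ((((N - 1 : ℕ) : ℝ≥0∞) *
                (∫⁻ X, kineticDensity Ψ.ψ X +
                  ENNReal.ofReal q *
                    (∑ i : Fin N, ENNReal.ofReal (ρb * (6 * Real.pi * L ^ 2 - ∫ y in box L, ‖X i - y‖⁻¹))) *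
                    (‖Ψ.ψ X‖₊ : ℝ≥0∞) ^ 2) +
              ((N - 2 : ℕ) : ℝ≥0∞) *
                (∫⁻ X, (interaction v X +
                  ENNReal.ofReal q * ∑ i : Fin N, ∑ j : Fin N with i < j, ENNReal.ofReal (‖X i - X j‖⁻¹)) *
                    (‖Ψ.ψ X‖₊ : ℝ≥0∞) ^ 2)) -
            (N : ℝ≥0∞) * chargedGroundStateEnergy v q ρb (N - 1) L) := by
  sorry

/-- **stub 3 — the Koopmans-defect bound for charged near-minimisers, NEUTRAL reference.** For every
admissible core `v` there are `C_Z ≥ 0` and `κ₀ > 0` such that for `0 < κ < κ₀` there is `ρ₀ > 0` with: for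
`0 < ρ < ρ₀` and all large `N`, some slack `δ > 0` makes every `δ`-near-minimiser `Ψ` of `chargedEnergy v
(κρ^{1/3}) ρ` in the box `L = sideLength ρ N` satisfy `Z(Ψ) = (N−1)T_{h'}(Ψ) + (N−2)W(Ψ) − N·E₀(N−1,ρ') ≤
C_Z κ ρ^{2/3} N`, where `ρ' = ρ(N−1)/N`, `T_{h'}` is the kinetic + `ρ'`-background one-body energy OF `Ψ` and
`E₀(N−1,ρ') = chargedGroundStateEnergy v q ρ' (N−1) L` (`stub_removalInequality` instantiated at `ρ_b := ρ'`).
Why plausibly true: `Z ≥ 0` (variational), `Z` is gauge invariant and `0` at Hartree level, Bogoliubov value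
`Σ_{k≠0} n_k·E_k = |E_corr| ≈ 0.48κ^{5/4}ρ^{2/3}N` (+ `O(aρN) = o(κρ^{2/3}N)` from the core as `ρ → 0` at fixed
`κ`). Proof plan (no boundary-layer analysis, no cross-`N` comparison): (i) Bose ground energy = Boltzmann
ground energy; (ii) insertion trial `Φ ⊗ η`, `η = √(ρ_Ψ/N)` (mollified; Dyson/Jastrow dressing for hard
cores), `Φ` a near-minimiser of the neutral `(N−1)`-problem, giving `E₀(N,ρ) ≤ E₀(N−1,ρ') + (1/N)∫u(ρ_Φ+ρ_Ψ)
+ t_η + (q/N)D(ρ_Ψ,ρ_Φ) + core`; (iii) all background-potential terms cancel except `(q/N)D(ρ_b1_Λ,σ_Ψ) =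
O(κρ^{2/3}L·…)`, `−T + Nt_η ≤ 0` (Hoffmann-Ostenhof), and `Z ≤ qD(σ_Ψ,σ'_Φ) − qD(σ_Ψ,σ_Ψ) − 2qE_xc(Ψ) + …`
with `qD(σ_Ψ,σ'_Φ) ≤ (q/2)(D(σ_Ψ,σ_Ψ) + D(σ'_Φ,σ'_Φ))` (Cauchy–Schwarz in the Coulomb norm), each `qD(σ,σ)`
and `−2qE_xc` being `O(κρ^{2/3}N)` by the energy budgets + Lieb–Oxford (+ no-piling `∫ρ^{4/3} ≤ CNρ^{1/3}`,
CLY / LS2001 Lemma 4.1 type) + `JelliumOnsagerBound`; (iv) near-minimiser ⇒ values at fixed `N` by lower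
semicontinuity. Against the BARE reference (background `ρ`, `N−1` bosons) an uncancelled `q∫V_bg(σ_Φ − σ_Ψ)`
with `V_bg ≍ ρL²` would remain — that typing is a trap and is NOT used. -/
theorem stub_koopmansDefect :
    ∀ v : ℝ → ℝ≥0∞, IsRepulsiveFiniteRange v →
      ∃ CZ : ℝ, 0 ≤ CZ ∧ ∃ κ₀ : ℝ, 0 < κ₀ ∧ ∀ κ : ℝ, 0 < κ → κ < κ₀ →
        ∃ ρ₀ : ℝ, 0 < ρ₀ ∧ ∀ ρ : ℝ, 0 < ρ → ρ < ρ₀ →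
          ∀ᶠ N : ℕ in atTop, ∃ δ : ℝ≥0∞, 0 < δ ∧ ∀ Ψ : TrialState N (sideLength ρ N),
            chargedEnergy v (κ * ρ ^ (1 / 3 : ℝ)) ρ Ψ ≤
                chargedGroundStateEnergy v (κ * ρ ^ (1 / 3 : ℝ)) ρ N (sideLength ρ N) + δ →
              ((((N - 1 : ℕ) : ℝ≥0∞) *
                    (∫⁻ X, kineticDensity Ψ.ψ X +
                      ENNReal.ofReal (κ * ρ ^ (1 / 3 : ℝ)) *
                        (∑ i : Fin N, ENNReal.ofReal
                          (ρ * ((N - 1 : ℕ) : ℝ) / (N : ℝ) *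
                            (6 * Real.pi * sideLength ρ N ^ 2 - ∫ y in box (sideLength ρ N), ‖X i - y‖⁻¹))) *
                        (‖Ψ.ψ X‖₊ : ℝ≥0∞) ^ 2) +
                  ((N - 2 : ℕ) : ℝ≥0∞) *
                    (∫⁻ X, (interaction v X +
                      ENNReal.ofReal (κ * ρ ^ (1 / 3 : ℝ)) *
                        ∑ i : Fin N, ∑ j : Fin N with i < j, ENNReal.ofReal (‖X i - X j‖⁻¹)) *
                        (‖Ψ.ψ X‖₊ : ℝ≥0∞) ^ 2)) -
                (N : ℝ≥0∞) *
                  chargedGroundStateEnergy v (κ * ρ ^ (1 / 3 : ℝ)) (ρ * ((N - 1 : ℕ) : ℝ) / (N : ℝ)) (N - 1)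
                    (sideLength ρ N)) ≤
              ENNReal.ofReal (CZ * κ * ρ ^ (2 / 3 : ℝ) * N) := by
  sorry

/-! ## Proved composition (no sorry below this line) -/

/-- The real-arithmetic heart of the composition: with `κ < (c_g/(2(C_Z+1)))²` the Koopmans defect
`C_Zκρ^{2/3}N` is at most half of `ωN`, `ω = c_g√κρ^{2/3}`. -/
theorem defect_le_half_gap {cg CZ κ ρ : ℝ} (hcg : 0 < cg) (hCZ : 0 ≤ CZ) (hκ : 0 < κ)
    (hκlt : κ < (cg / (2 * (CZ + 1))) ^ 2) (hρ : 0 < ρ) (N : ℕ) :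
    CZ * κ * ρ ^ (2 / 3 : ℝ) * N ≤ cg * Real.sqrt κ * ρ ^ (2 / 3 : ℝ) * N / 2 := by
  have hs : 0 < Real.sqrt κ := Real.sqrt_pos.2 hκ
  have hsq : Real.sqrt κ * Real.sqrt κ = κ := Real.mul_self_sqrt hκ.le
  have hb : 0 < cg / (2 * (CZ + 1)) := by positivity
  have hslt : Real.sqrt κ < cg / (2 * (CZ + 1)) := by
    calc Real.sqrt κ < Real.sqrt ((cg / (2 * (CZ + 1))) ^ 2) := Real.sqrt_lt_sqrt hκ.le hκlt
      _ = cg / (2 * (CZ + 1)) := Real.sqrt_sq hb.le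
  -- CZ κ = CZ √κ √κ ≤ CZ · (cg/(2(CZ+1))) · √κ ≤ (cg/2) √κ
  have h1 : CZ * κ ≤ cg / 2 * Real.sqrt κ := by
    have h2 : CZ * Real.sqrt κ ≤ CZ * (cg / (2 * (CZ + 1))) :=
      mul_le_mul_of_nonneg_left hslt.le hCZ
    have h3 : CZ * (cg / (2 * (CZ + 1))) ≤ cg / 2 := by
      have : CZ / (2 * (CZ + 1)) ≤ 1 / 2 := by
        rw [div_le_div_iff₀ (by positivity) (by norm_num)]
        nlinarith
      calc CZ * (cg / (2 * (CZ + 1))) = cg * (CZ / (2 * (CZ + 1))) := by ring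
        _ ≤ cg * (1 / 2) := mul_le_mul_of_nonneg_left this hcg.le
        _ = cg / 2 := by ring
    calc CZ * κ = CZ * Real.sqrt κ * Real.sqrt κ := by rw [mul_assoc, hsq]
      _ ≤ CZ * (cg / (2 * (CZ + 1))) * Real.sqrt κ := mul_le_mul_of_nonneg_right h2 hs.le
      _ ≤ cg / 2 * Real.sqrt κ := mul_le_mul_of_nonneg_right h3 hs.le
  have hρN : 0 ≤ ρ ^ (2 / 3 : ℝ) * N := by positivity
  calc CZ * κ * ρ ^ (2 / 3 : ℝ) * N = (CZ * κ) * (ρ ^ (2 / 3 : ℝ) * N) := by ring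
    _ ≤ (cg / 2 * Real.sqrt κ) * (ρ ^ (2 / 3 : ℝ) * N) := mul_le_mul_of_nonneg_right h1 hρN
    _ = cg * Real.sqrt κ * ρ ^ (2 / 3 : ℝ) * N / 2 := by ring

/-- The `ℝ≥0∞` cancellation: `ofReal ω · N ≤ ofReal ω · m + ofReal (ωN/2)` with `ω > 0` forces
`ofReal (N/2) ≤ m`. -/
theorem half_le_of_gap_bound {ω : ℝ} (hω : 0 < ω) (N : ℕ) {m : ℝ≥0∞}
    (h : ENNReal.ofReal ω * N ≤ ENNReal.ofReal ω * m + ENNReal.ofReal (ω * N / 2)) :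
    ENNReal.ofReal ((1 / 2 : ℝ) * N) ≤ m := by
  have hωN : ENNReal.ofReal ω * (N : ℝ≥0∞) = ENNReal.ofReal (ω * N / 2) + ENNReal.ofReal (ω * N / 2) := by
    rw [← ENNReal.ofReal_natCast, ← ENNReal.ofReal_mul hω.le,
      ← ENNReal.ofReal_add (by positivity) (by positivity)]
    congr 1
    ring
  rw [hωN] at h
  have h' : ENNReal.ofReal (ω * N / 2) ≤ ENNReal.ofReal ω * m :=
    (ENNReal.add_le_add_iff_right ENNReal.ofReal_ne_top).1 h
  have hsplit : ENNReal.ofReal (ω * N / 2) = ENNReal.ofReal ω * ENNReal.ofReal ((1 / 2 : ℝ) * N) := by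
    rw [← ENNReal.ofReal_mul hω.le]
    congr 1
    ring
  rw [hsplit] at h'
  exact (ENNReal.mul_le_mul_iff_right ((ENNReal.ofReal_pos.2 hω).ne') ENNReal.ofReal_ne_top).1 h'

/-- **Composition with the stub STATEMENTS as hypotheses (kernel-checked, no sorry):**
`stub₁-signature → stub₂-signature → stub₃-signature → <vocabulary form of the crux>` (the crux unfolds to it
by `rfl`). Thresholds: `κ₀ := min κ₁ (min κ₂ (c_g/(2(C_Z+1)))²)`, `ρ₀ := min ρ₁ ρ₂`, `c := 1/2`; on the
intersection of the two eventual sets take the slack `δ` of stub 3; every `δ`-near-minimiser satisfies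
`ωN ≤ ω·λ_max + Z` (stub 2 fed by stub 1) and `Z ≤ C_Zκρ^{2/3}N ≤ ωN/2`, hence `λ_max ≥ N/2`, and
`JelliumBoseGas.le_chargedCondensateNumber` closes. -/
theorem ChargedGasBEC_of_sigs :
    (∀ v : ℝ → ℝ≥0∞, IsRepulsiveFiniteRange v →
      ∃ cg : ℝ, 0 < cg ∧ ∃ κ₀ : ℝ, 0 < κ₀ ∧ ∀ κ : ℝ, 0 < κ → κ < κ₀ →
        ∃ ρ₀ : ℝ, 0 < ρ₀ ∧ ∀ ρ : ℝ, 0 < ρ → ρ < ρ₀ →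
          ∀ᶠ N : ℕ in atTop,
            chargedGroundStateEnergy v (κ * ρ ^ (1 / 3 : ℝ)) (ρ * ((N - 1 : ℕ) : ℝ) / (N : ℝ)) (N - 1)
                (sideLength ρ N) ≠ ⊤ ∧
            2 * chargedGroundStateEnergy v (κ * ρ ^ (1 / 3 : ℝ)) (ρ * ((N - 1 : ℕ) : ℝ) / (N : ℝ)) (N - 1)
                  (sideLength ρ N) +
                ENNReal.ofReal (cg * Real.sqrt κ * ρ ^ (2 / 3 : ℝ)) ≤
              ⨅ (Φ₁ : TrialState (N - 1) (sideLength ρ N)) (Φ₂ : TrialState (N - 1) (sideLength ρ N))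
                (_ : ∫ X, conj (Φ₁.ψ X) * Φ₂.ψ X = 0),
                chargedEnergy v (κ * ρ ^ (1 / 3 : ℝ)) (ρ * ((N - 1 : ℕ) : ℝ) / (N : ℝ)) Φ₁ +
                  chargedEnergy v (κ * ρ ^ (1 / 3 : ℝ)) (ρ * ((N - 1 : ℕ) : ℝ) / (N : ℝ)) Φ₂) →
    (∀ (v : ℝ → ℝ≥0∞) (q ρb : ℝ) (N : ℕ) (L ω : ℝ),
      chargedGroundStateEnergy v q ρb (N - 1) L ≠ ⊤ →
      2 * chargedGroundStateEnergy v q ρb (N - 1) L + ENNReal.ofReal ω ≤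
          ⨅ (Φ₁ : TrialState (N - 1) L) (Φ₂ : TrialState (N - 1) L)
            (_ : ∫ X, conj (Φ₁.ψ X) * Φ₂.ψ X = 0),
            chargedEnergy v q ρb Φ₁ + chargedEnergy v q ρb Φ₂ →
      ∀ Ψ : TrialState N L,
        ENNReal.ofReal ω * N ≤ ENNReal.ofReal ω * maxOccupation N Ψ.ψ +
          ((((N - 1 : ℕ) : ℝ≥0∞) *
                (∫⁻ X, kineticDensity Ψ.ψ X +
                  ENNReal.ofReal q *
                    (∑ i : Fin N, ENNReal.ofReal (ρb * (6 * Real.pi * L ^ 2 - ∫ y in box L, ‖X i - y‖⁻¹))) *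
                    (‖Ψ.ψ X‖₊ : ℝ≥0∞) ^ 2) +
              ((N - 2 : ℕ) : ℝ≥0∞) *
                (∫⁻ X, (interaction v X +
                  ENNReal.ofReal q * ∑ i : Fin N, ∑ j : Fin N with i < j, ENNReal.ofReal (‖X i - X j‖⁻¹)) *
                    (‖Ψ.ψ X‖₊ : ℝ≥0∞) ^ 2)) -
            (N : ℝ≥0∞) * chargedGroundStateEnergy v q ρb (N - 1) L)) →
    (∀ v : ℝ → ℝ≥0∞, IsRepulsiveFiniteRange v →
      ∃ CZ : ℝ, 0 ≤ CZ ∧ ∃ κ₀ : ℝ, 0 < κ₀ ∧ ∀ κ : ℝ, 0 < κ → κ < κ₀ →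
        ∃ ρ₀ : ℝ, 0 < ρ₀ ∧ ∀ ρ : ℝ, 0 < ρ → ρ < ρ₀ →
          ∀ᶠ N : ℕ in atTop, ∃ δ : ℝ≥0∞, 0 < δ ∧ ∀ Ψ : TrialState N (sideLength ρ N),
            chargedEnergy v (κ * ρ ^ (1 / 3 : ℝ)) ρ Ψ ≤
                chargedGroundStateEnergy v (κ * ρ ^ (1 / 3 : ℝ)) ρ N (sideLength ρ N) + δ →
              ((((N - 1 : ℕ) : ℝ≥0∞) *
                    (∫⁻ X, kineticDensity Ψ.ψ X +
                      ENNReal.ofReal (κ * ρ ^ (1 / 3 : ℝ)) *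
                        (∑ i : Fin N, ENNReal.ofReal
                          (ρ * ((N - 1 : ℕ) : ℝ) / (N : ℝ) *
                            (6 * Real.pi * sideLength ρ N ^ 2 - ∫ y in box (sideLength ρ N), ‖X i - y‖⁻¹))) *
                        (‖Ψ.ψ X‖₊ : ℝ≥0∞) ^ 2) +
                  ((N - 2 : ℕ) : ℝ≥0∞) *
                    (∫⁻ X, (interaction v X +
                      ENNReal.ofReal (κ * ρ ^ (1 / 3 : ℝ)) *
                        ∑ i : Fin N, ∑ j : Fin N with i < j, ENNReal.ofReal (‖X i - X j‖⁻¹)) *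
                        (‖Ψ.ψ X‖₊ : ℝ≥0∞) ^ 2)) -
                (N : ℝ≥0∞) *
                  chargedGroundStateEnergy v (κ * ρ ^ (1 / 3 : ℝ)) (ρ * ((N - 1 : ℕ) : ℝ) / (N : ℝ)) (N - 1)
                    (sideLength ρ N)) ≤
              ENNReal.ofReal (CZ * κ * ρ ^ (2 / 3 : ℝ) * N)) →
    ∀ v : ℝ → ℝ≥0∞, IsRepulsiveFiniteRange v →
      ∃ κ₀ : ℝ, 0 < κ₀ ∧ ∀ κ : ℝ, 0 < κ → κ < κ₀ → ∃ ρ₀ : ℝ, 0 < ρ₀ ∧ ∀ ρ : ℝ, 0 < ρ → ρ < ρ₀ →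
        ∃ c : ℝ, 0 < c ∧ ∀ᶠ N : ℕ in atTop,
          ENNReal.ofReal (c * N) ≤
            chargedCondensateNumber v (κ * ρ ^ (1 / 3 : ℝ)) ρ N (sideLength ρ N) := by
  intro hG hK hZ v hv
  obtain ⟨cg, hcg, κ₁, hκ₁, hG⟩ := hG v hv
  obtain ⟨CZ, hCZ, κ₂, hκ₂, hZ⟩ := hZ v hv
  have hκ₃ : 0 < (cg / (2 * (CZ + 1))) ^ 2 := by positivity
  refine ⟨min κ₁ (min κ₂ ((cg / (2 * (CZ + 1))) ^ 2)), lt_min hκ₁ (lt_min hκ₂ hκ₃), fun κ hκ hκlt => ?_⟩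
  have hκlt₁ : κ < κ₁ := lt_of_lt_of_le hκlt (min_le_left _ _)
  have hκlt₂ : κ < κ₂ := lt_of_lt_of_le hκlt ((min_le_right _ _).trans (min_le_left _ _))
  have hκlt₃ : κ < (cg / (2 * (CZ + 1))) ^ 2 :=
    lt_of_lt_of_le hκlt ((min_le_right _ _).trans (min_le_right _ _))
  obtain ⟨ρ₁, hρ₁, hG⟩ := hG κ hκ hκlt₁
  obtain ⟨ρ₂, hρ₂, hZ⟩ := hZ κ hκ hκlt₂
  refine ⟨min ρ₁ ρ₂, lt_min hρ₁ hρ₂, fun ρ hρ hρlt => ?_⟩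
  have hG := hG ρ hρ (lt_of_lt_of_le hρlt (min_le_left _ _))
  have hZ := hZ ρ hρ (lt_of_lt_of_le hρlt (min_le_right _ _))
  refine ⟨1 / 2, by norm_num, ?_⟩
  filter_upwards [hG, hZ] with N hGN hZN
  obtain ⟨hfin, hgap⟩ := hGN
  obtain ⟨δ, hδ, hZN⟩ := hZN
  -- the gap, a positive real number
  set ω : ℝ := cg * Real.sqrt κ * ρ ^ (2 / 3 : ℝ) with hωdef
  have hω : 0 < ω := by
    have : 0 < Real.sqrt κ := Real.sqrt_pos.2 hκ
    positivity
  refine le_chargedCondensateNumber v _ ρ hδ fun Ψ hΨ => ?_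
  have h1 := hK v (κ * ρ ^ (1 / 3 : ℝ)) (ρ * ((N - 1 : ℕ) : ℝ) / (N : ℝ)) N (sideLength ρ N) ω hfin hgap Ψ
  have h2 := hZN Ψ hΨ
  have h3 : ENNReal.ofReal (CZ * κ * ρ ^ (2 / 3 : ℝ) * N) ≤ ENNReal.ofReal (ω * N / 2) :=
    ENNReal.ofReal_le_ofReal (defect_le_half_gap hcg hCZ hκ hκlt₃ hρ N)
  exact half_le_of_gap_bound hω N (h1.trans (add_le_add le_rfl (h2.trans h3)))

/-- **THE SKELETON THEOREM — the crux BY NAME from the three stubs** (the only theorem of this file whose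
conclusion is the crux constant; its only `sorry`s are the three `stub_*`, reached through
`ChargedGasBEC_of_sigs`; the inline `let`s of the route item unfold to the vocabulary form definitionally). -/
theorem ChargedGasBEC_of :
    Summit.AtomisticToContinuum.BoseEinsteinCondensation.Theses.BECJelliumDischarge.ChargedGasBEC :=
  ChargedGasBEC_of_sigs stub_pairGap stub_removalInequality stub_koopmansDefect

end Summit.AtomisticToContinuum.BoseEinsteinCondensation.Cruxes.ChargedGasBEC.PlasmonGapRemoval

end
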